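import Summits.BirchSwinnertonDyer.BirchSwinnertonDyer.Theorems.KimAtThreePortSharedSATCore
import Summits.BirchSwinnertonDyer.BirchSwinnertonDyer.Theorems.KimAtThreeFineKatoSemiLocalLattice
import HarnessLib

/-!
# Route `KimAtThreeKolyvagin` (W2), crux `KatoKuriharaPortThreeShared` (item 19560), registered stub
# `stub_fineKato` = ⟨C1⟩, clause (C1.c) = SAT₀: the lattice `L_int′(m) = ℤ_p⟨1 ⊗ 𝓞_{ℚ(ζ_m)}⟩`
# has the two scalar properties SAT₀ uses (multiplicatively closed, trace into `ℤ_p`)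

Cell `bsd-addord`, seat `bsd-addord-w2-acc4` (gen 3); `--supports stmt-BirchSwinnertonDyer-19560`.
Theorems only (no definition, no named fact, no `sorry`); nothing asserted about any curve.

WHY.  The semi-local isomorphism `Ψ : ℚ_[p] ⊗[ℚ] ℚ(ζ_m) ≃ₐ[ℚ] ∏_{w ∣ v_p} ℚ(ζ_m)_w`
(`Literature/NumberTheory/AdelicBaseChange/PadicTensorCompletion{,Trace,Surj}Proofs`) identifies
`∏_w 𝒪_w` with the `ℤ_p`-span `L_int′(m)` of the `1 ⊗ b`, `b ∈ 𝓞_{ℚ(ζ_m)}` — INTO and ONTO — whereas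
the rider's lattice `cycIntLattice p m = ℤ_p⟨(1 ⊗ ζ_m)^j⟩ ⊆ L_int′(m)`
(`KimAtThreeFineKatoSemiLocalLattice.cycIntLattice_le_span_ringOfIntegers`) is only known to be INTO
(equality needs `𝓞_{ℚ(ζ_m)} = ℤ[ζ_m]`, in Mathlib for prime powers only).  The SAT₀ scalar core
(`KimAtThreePortSharedSATCore`: `norm_le_one_of_algebraMap_eq_add`, abstract in the lattice `L`) and
kim3's rider assembly therefore want `L := L_int′(m)`; this file supplies for `L_int′(m)` the two inputs
that `KimAtThreePortSharedSATCore` proved for `cycIntLattice`: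

* `mul_mem_span_ringOfIntegers` — `L_int′(m)` is closed under multiplication;
* `norm_trace_le_one_of_mem_span_ringOfIntegers` — `‖Tr_{(ℚ_p ⊗ ℚ(ζ_m))/ℚ_p}(l)‖ ≤ 1` on `L_int′(m)`
  (the trace of an algebraic integer is a rational integer);
* `norm_trace_mul_le_one_span_ringOfIntegers` — (hL) for ANY `Λ₀ ⊆ L_int′(m)`;
  `cycIntLattice_premise_mem_span_ringOfIntegers` — rider (ii)'s premise `∃ l ∈ cycIntLattice, …`
  implies the same with `L_int′(m)`.
[cite: Kim2022StructureSelmer, §3.4.1 and the proof of Thm. 3.13 (arXiv v3 pp. 26–27)]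
-/

set_option autoImplicit false
-- the Theorems namespace of a single-conjunct summit repeats the summit name by design (D-0017)
set_option linter.dupNamespace false

noncomputable section

open scoped TensorProduct NumberField
open NumberField
open Summit.BirchSwinnertonDyer.Rank1Residual.GaloisImage
open Summit.BirchSwinnertonDyer.BirchSwinnertonDyer.Theorems.KimAtThreePortSharedSATCore

namespace Summit.BirchSwinnertonDyer.BirchSwinnertonDyer.Theorems.KimAtThreeFineKatoSemiLocalLatticeInt

variable (p : ℕ) [Fact p.Prime] (m : ℕ)

set_option backward.isDefEq.respectTransparency false in
/-- **`L_int′(m)` is closed under multiplication** (`(1 ⊗ b)(1 ⊗ b′) = 1 ⊗ bb′`). [folklore] -/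
theorem mul_mem_span_ringOfIntegers {x y : ℚ_[p] ⊗[ℚ] CyclotomicField m ℚ}
    (hx : x ∈ Submodule.span ℤ_[p]
      (Set.range fun b : 𝓞 (CyclotomicField m ℚ) ↦ (1 : ℚ_[p]) ⊗ₜ[ℚ] (b : CyclotomicField m ℚ)))
    (hy : y ∈ Submodule.span ℤ_[p]
      (Set.range fun b : 𝓞 (CyclotomicField m ℚ) ↦ (1 : ℚ_[p]) ⊗ₜ[ℚ] (b : CyclotomicField m ℚ))) :
    x * y ∈ Submodule.span ℤ_[p]
      (Set.range fun b : 𝓞 (CyclotomicField m ℚ) ↦ (1 : ℚ_[p]) ⊗ₜ[ℚ] (b : CyclotomicField m ℚ)) := by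
  induction hx using Submodule.span_induction generalizing y with
  | mem x hx' =>
    obtain ⟨b, rfl⟩ := hx'
    induction hy using Submodule.span_induction with
    | mem y hy' =>
      obtain ⟨b', rfl⟩ := hy'
      refine Submodule.subset_span ⟨b * b', ?_⟩
      dsimp only
      rw [Algebra.TensorProduct.tmul_mul_tmul, one_mul]
      rfl
    | zero => rw [mul_zero]; exact Submodule.zero_mem _
    | add a c _ _ ha hc => rw [mul_add]; exact Submodule.add_mem _ ha hc
    | smul r a _ ha => rw [mul_smul_comm]; exact Submodule.smul_mem _ r ha
  | zero => rw [zero_mul]; exact Submodule.zero_mem _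
  | add a c _ _ ha hc => rw [add_mul]; exact Submodule.add_mem _ (ha hy) (hc hy)
  | smul r a _ ha => rw [smul_mul_assoc]; exact Submodule.smul_mem _ r (ha hy)

set_option backward.isDefEq.respectTransparency false in
/-- `Tr_{ℚ(ζ_m)/ℚ}(b) ∈ ℤ` for an algebraic integer `b` (the trace of an integral element over the
integrally closed `ℤ` is integral). [folklore] -/
theorem exists_int_cast_eq_trace_ringOfIntegers (b : 𝓞 (CyclotomicField m ℚ)) :
    ∃ n : ℤ, (n : ℚ) = Algebra.trace ℚ (CyclotomicField m ℚ) (b : CyclotomicField m ℚ) := by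
  have hb : IsIntegral ℤ (b : CyclotomicField m ℚ) := NumberField.RingOfIntegers.isIntegral_coe b
  have htr : IsIntegral ℤ (Algebra.trace ℚ (CyclotomicField m ℚ) (b : CyclotomicField m ℚ)) :=
    Algebra.isIntegral_trace hb
  obtain ⟨n, hn⟩ := IsIntegrallyClosed.isIntegral_iff.mp htr
  exact ⟨n, by simpa using hn⟩

set_option backward.isDefEq.respectTransparency false in
/-- **The trace is integral on `L_int′(m)`**: `‖Tr_{(ℚ_p ⊗ ℚ(ζ_m))/ℚ_p}(l)‖ ≤ 1` for `l ∈ L_int′(m)`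
(generators: `Tr(1 ⊗ b) = Tr_{ℚ(ζ_m)/ℚ}(b) ∈ ℤ` by `trace_one_tmul`; `ℤ_p`-span and the ultrametric
inequality). [folklore] -/
theorem norm_trace_le_one_of_mem_span_ringOfIntegers {l : ℚ_[p] ⊗[ℚ] CyclotomicField m ℚ}
    (hl : l ∈ Submodule.span ℤ_[p]
      (Set.range fun b : 𝓞 (CyclotomicField m ℚ) ↦ (1 : ℚ_[p]) ⊗ₜ[ℚ] (b : CyclotomicField m ℚ))) :
    ‖Algebra.trace ℚ_[p] (ℚ_[p] ⊗[ℚ] CyclotomicField m ℚ) l‖ ≤ 1 := by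
  induction hl using Submodule.span_induction with
  | mem x hx =>
    obtain ⟨b, rfl⟩ := hx
    obtain ⟨n, hn⟩ := exists_int_cast_eq_trace_ringOfIntegers m b
    dsimp only
    rw [trace_one_tmul, ← hn, map_intCast]
    exact Padic.norm_int_le_one n
  | zero => rw [map_zero, norm_zero]; exact zero_le_one
  | add a c _ _ ha hc =>
    rw [map_add]
    exact (Padic.nonarchimedean _ _).trans (max_le ha hc)
  | smul r a _ ha =>
    rw [padicInt_smul_eq_coe_smul, map_smul, smul_eq_mul, norm_mul]
    exact mul_le_one₀ (PadicInt.norm_le_one r) (norm_nonneg _) ha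

/-- **(hL) for the trace on `L_int′(m)`**: for ANY `Λ₀ ⊆ L_int′(m)`, `‖Tr(o·ℓ)‖ ≤ 1` for `o ∈ L_int′(m)`,
`ℓ ∈ Λ₀` (the input `hL` of `KimAtThreePortSharedSATCore.norm_le_one_of_algebraMap_eq_add` with
`L := L_int′(m)`). [folklore] -/
theorem norm_trace_mul_le_one_span_ringOfIntegers {Λ₀ : Set (ℚ_[p] ⊗[ℚ] CyclotomicField m ℚ)}
    (hΛ₀ : Λ₀ ⊆ Submodule.span ℤ_[p]
      (Set.range fun b : 𝓞 (CyclotomicField m ℚ) ↦ (1 : ℚ_[p]) ⊗ₜ[ℚ] (b : CyclotomicField m ℚ))) :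
    ∀ o ∈ (Submodule.span ℤ_[p]
      (Set.range fun b : 𝓞 (CyclotomicField m ℚ) ↦ (1 : ℚ_[p]) ⊗ₜ[ℚ] (b : CyclotomicField m ℚ)) :
        Set (ℚ_[p] ⊗[ℚ] CyclotomicField m ℚ)), ∀ ℓ ∈ Λ₀,
      ‖Algebra.trace ℚ_[p] (ℚ_[p] ⊗[ℚ] CyclotomicField m ℚ) (o * ℓ)‖ ≤ 1 :=
  fun _ ho _ hℓ ↦ norm_trace_le_one_of_mem_span_ringOfIntegers p m
    (mul_mem_span_ringOfIntegers p m ho (hΛ₀ hℓ))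

set_option backward.isDefEq.respectTransparency false in
/-- **Rider (ii)'s premise in the `L_int′(m)` currency**: `∃ l ∈ cycIntLattice p m, v − s ⊗ 1 = p^{k+1}•l`
implies the same with `L_int′(m)` (`cycIntLattice ≤ L_int′`). [cite: Kim2022StructureSelmer, §3.4.1 and the proof of Thm. 3.13 (arXiv v3 pp. 26–27)] -/
theorem cycIntLattice_premise_mem_span_ringOfIntegers [NeZero m] {v w : ℚ_[p] ⊗[ℚ] CyclotomicField m ℚ}
    {k : ℕ}
    (h : ∃ l ∈ cycIntLattice p m, v - w = ((p : ℤ_[p]) ^ (k + 1)) • l) :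
    ∃ l ∈ Submodule.span ℤ_[p]
      (Set.range fun b : 𝓞 (CyclotomicField m ℚ) ↦ (1 : ℚ_[p]) ⊗ₜ[ℚ] (b : CyclotomicField m ℚ)),
      v - w = ((p : ℤ_[p]) ^ (k + 1)) • l := by
  obtain ⟨l, hl, hvw⟩ := h
  exact ⟨l, KimAtThreeFineKatoSemiLocalLattice.cycIntLattice_le_span_ringOfIntegers p m hl, hvw⟩

end Summit.BirchSwinnertonDyer.BirchSwinnertonDyer.Theorems.KimAtThreeFineKatoSemiLocalLatticeInt

end
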